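import Summits.HodgeConjecture.HodgeConjecture.Theorems.DworkReflectionQuotientsK2TopCharacter
import Summits.HodgeConjecture.HodgeConjecture.Theorems.DworkReflectionQuotientsTypeOneHodgeOfFermat
import Literature.AlgebraicGeometry.HodgeTheory.FermatFourfoldConeClaims

/-!
# Crux K2 `FlatClassesSpannedByReflectionInvariants` and its child `TypeOneHodge` modulo the CONE-SPAN
# leaf (III-l) of Aoki's Thm. 1-4 (i)

Route `route-HodgeConjecture-DworkReflectionQuotients` (cell `hodge-nonav`, rung F-H1 — never summit
credit), items `stmt-HodgeConjecture-20241` (crux K2) and `stmt-HodgeConjecture-21152` (child 2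
`TypeOneHodge`); landed `--supports stmt-HodgeConjecture-20241`. Prover seat `hodge-nonav-20241-p1` (g5),
2026-08-27. CONDITIONAL results (no item is closed here).

After g4 (`…K2TopCharacter`, `…TypeOneHodgeOfFermat`) the crux is implied by child 2 alone, and child 2 by
four explicit statements claim(`α`) on the Fermat sextic fourfold `X⁴₆`,
`α = (1,2,2,3,5,5), (3,4,4,5,1,1), (5,4,4,3,1,1), (3,2,2,1,5,5)`. Each is a pair `{c,-c} = {1,5}`
juxtaposed with a Hodge character of the Fermat sextic SURFACE (`(2,2,3,5)`, `(3,4,4,1) ∈ 𝔅²₆`), so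
(`Literature/…/FermatFourfoldConeClaims`: Aoki–Shioda (2.1) is a theorem of the tree) the four claims
follow from the single named leaf `Shioda1979_coneSpan_represents_left` — the completed cones over a
Hodge eigenline of `X²ₘ` with vertex a point of `X⁰ₘ` represent `(c,-c) ∗ β` (Aoki 1987 Thm. 1-4 (i),
`r = 0`), the leaf (III-l) shared with the cruxes `FermatAnchorAssembly` (stmt-14874) and
`HodgeFermatVarieties` (stmt-1334) — or from its parent `Aoki1987_claim_juxtaposition`:

* `typeOneHodge_of_coneSpan` — child 2 modulo (III-l);
* `flatClassesSpannedByReflectionInvariants_of_coneSpan` — the crux modulo (III-l): a FOURTH independent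
  conditional closure next to `…_of_katz` (Katz 2009), `…_of_griffiths` (Griffiths 1969), `…_of_shioda`
  (Shioda 1979 PJA §4, ruled join of two curves);
* `flatClassesSpannedByReflectionInvariants_of_juxtaposition` — the crux modulo Aoki's Thm. 1-4 (i).

## References

* N. Aoki, *Some new algebraic cycles on Fermat varieties*, J. Math. Soc. Japan 39 (1987), Thm. 1-4 (i)
  p. 388, p. 386. [Aoki1987]
* N. Aoki, T. Shioda, *Generators of the Néron–Severi group of a Fermat surface*, Progr. Math. 35 (1983),
  §2 (2.1). [AokiShioda1983]
* N. M. Katz, *Another look at the Dwork family*, Progr. Math. 270 (2009), §3, Lemma 3.1. [Katz2009]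
* G. Bini, A. Garbagnati, *Quotients of the Dwork pencil*, J. Geom. Phys. 75 (2014), §3.4. [BiniGarbagnati2012]
-/

namespace Summit.HodgeConjecture.HodgeConjecture.Theorems

open Literature.AlgebraicGeometry.HodgeTheory

/-- **Child 2 `TypeOneHodge` modulo the cone-span leaf (III-l)** (`typeOneHodge_of_fermatClaims` on the
four claims of `fermatSextic_claims_typeOne_of_coneSpan`). CONDITIONAL on
`Shioda1979_coneSpan_represents_left`. [cite: Katz2009, Lemma 3.1] [cite: Aoki1987, Thm. 1-4 (i) p. 388] -/
theorem typeOneHodge_of_coneSpan (hC : Shioda1979_coneSpan_represents_left) :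
    Summit.HodgeConjecture.HodgeConjecture.Theses.DworkReflectionQuotients.TypeOneHodge := by
  obtain ⟨h₁, h₂, h₃, h₄⟩ := fermatSextic_claims_typeOne_of_coneSpan hC
  exact typeOneHodge_of_fermatClaims h₁ h₂ h₃ h₄

/-- **Crux K2 `FlatClassesSpannedByReflectionInvariants` modulo the cone-span leaf (III-l)**
(`flatClassesSpannedByReflectionInvariants_of_fermatClaims` on the four claims): the fourth independent
conditional closure of the crux, resting on cones over two Hodge eigenlines of the Fermat sextic surface.
CONDITIONAL on `Shioda1979_coneSpan_represents_left`. [cite: Katz2009, §3 and Lemma 3.1]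
[cite: Aoki1987, Thm. 1-4 (i) p. 388 and p. 386] [cite: AokiShioda1983, §2 (2.1)] [cite: BiniGarbagnati2012, §3.4] -/
theorem flatClassesSpannedByReflectionInvariants_of_coneSpan (hC : Shioda1979_coneSpan_represents_left) :
    Summit.HodgeConjecture.HodgeConjecture.Theses.DworkReflectionQuotients.FlatClassesSpannedByReflectionInvariants := by
  obtain ⟨h₁, h₂, h₃, h₄⟩ := fermatSextic_claims_typeOne_of_coneSpan hC
  exact flatClassesSpannedByReflectionInvariants_of_fermatClaims h₁ h₂ h₃ h₄

/-- **Crux K2 modulo Aoki's Thm. 1-4 (i)** (`Aoki1987_claim_juxtaposition`): juxtapose `(1,5)` (claim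
trivial on `X⁰₆`) with `(2,2,3,5)`, `(3,4,4,1) ∈ 𝔅²₆` (Aoki–Shioda). CONDITIONAL on that named fact.
[cite: Aoki1987, Thm. 1-4 (i) p. 388] [cite: Katz2009, Lemma 3.1] -/
theorem flatClassesSpannedByReflectionInvariants_of_juxtaposition (hJ : Aoki1987_claim_juxtaposition) :
    Summit.HodgeConjecture.HodgeConjecture.Theses.DworkReflectionQuotients.FlatClassesSpannedByReflectionInvariants := by
  obtain ⟨h₁, h₂, h₃, h₄⟩ := fermatSextic_claims_typeOne_of_juxtaposition hJ
  exact flatClassesSpannedByReflectionInvariants_of_fermatClaims h₁ h₂ h₃ h₄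

end Summit.HodgeConjecture.HodgeConjecture.Theorems
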